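import Summits.BirchSwinnertonDyer.BirchSwinnertonDyer.Theorems.ManinLocalTwoThreeCDivisionNeronPeriodsConsumers
import Summits.BirchSwinnertonDyer.BirchSwinnertonDyer.Theorems.ManinLocalTwoThreeCDivisionOddSquarefreeResidual
import HarnessLib

/-!
# THE `c`-DIVISION WITNESS ∧ CDT — PART 3 (§6–§7 of -an g45's `CDivisionNeronPeriods-an-g45.lean` v3 sha16 3b8e276f040d6fd5, VERBATIM;
# landing copy prover p3 gen 18 for T-an-g45): the `Γ₁` side (Stevens' `|c₁| = 1` from ONE law) and the corollaries MODULO THE PRINTED CDT FACT ONLY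
# (E-an-242 discharged by `cDivisionWitnessLaw_holds := CDivAssembly.exists_cDivisionWitness`, p754408): Stevens I strong, `|c₀| = 1` at odd `p² ∣ N`,
# `c₀ ∣ 2` at `4 ∣ N`, C2 ⟸ CDT ∧ E-an-152c (or 152d ∧ 152e), `ManinConstantOne` ⟸ Printed ∧ CDT ∧ 152c.
Landing note (p3 gen 19): §7's `abs_maninConstant_eq_one_of_CDT_of_odd_sq_dvd` and C4 `maninPrimeToAdditiveFiveLe_of_CDT` are NOT restated here — they
already landed as `CDivisionUDC.abs_maninConstant_eq_one_of_CDT_of_odd_sq_dvd` / `CDivisionUDC.maninPrimeToAdditiveFiveLe_of_CDT`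
(`…CDivisionOddSquarefreeResidual.lean`, p755101) and are imported and cited by name below.
See PART 1 `…CDivisionNeronPeriods.lean` for the full module commentary.  HONEST FRAMING: CONDITIONAL on the printed CDT theorem (not proved in the tree)
and the named open rows; BSD is not proved; Manin's conjecture is not proved unconditionally.  No sorry; no new definitions beyond `Prop` rows.
[cite: CalegariDimitrovTang2025, Thm. 1.0.1 and Remarks 58–59] [cite: Stevens1989, §2] [cite: LingOesterle1991, Thm. 6]
-/

set_option autoImplicit false
-- lint-debt: the directory name repeats the summit name (sibling precedent `ManinLocalTwoThreeDivisionCoverUDC.lean`)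
set_option linter.dupNamespace false

noncomputable section

open scoped MatrixGroups ModularForm Manifold
open CongruenceSubgroup Complex ModularGroup
open WeierstrassCurve Literature.NumberTheory.EllipticCurves Literature.NumberTheory.EllipticCurves.ModularForms
open Literature.NumberTheory.Automorphic
open Summit.BirchSwinnertonDyer.Rank1Residual.ManinAdditive.UDCKummerLineK
open Summit.BirchSwinnertonDyer.Rank1Residual.ManinAdditive.ShimuraKernel

namespace Summit.BirchSwinnertonDyer.BirchSwinnertonDyer.Theorems.ManinLocalTwoThree.CDivisionNeron

variable {W : WeierstrassCurve ℚ} [W.IsElliptic] [W.IsGloballyMinimal] {N : ℕ} [NeZero N]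

/-! ## §6 The `Γ₁` side: Stevens' `|c₁| = 1` from ONE law -/

omit [W.IsElliptic] [W.IsGloballyMinimal] in
/-- **`|c₁| = 1` for every OPTIMAL `X₁(N)`-datum ⟸ `Λ₁(f) ⊆ Λ_W`** (`Λ_W = c₁Λ₁(f)`: `ω₁ = c₁w₁`, `w₁ ∈ Λ₁ ⊆ Λ_W`, so `(1/c₁)ω₁ ∈ Λ_W`, `c₁ ∣ 1`).
Unconditional implication. [cite: Stevens1989, §2] [cite: CesnaviciusNeururerSaha2023, Lemma 6.5] -/
theorem abs_maninConstant₁_eq_one_of_gamma1Periods_le (D : Gamma1ParametrizationData W N) (hopt : D.IsOptimal)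
    (hSI : ∀ γ : Gamma1 N, cuspSymbol D.f ⟨(γ : SL(2, ℤ)), Gamma1_in_Gamma0 N γ.2⟩ ∈ D.L.lattice) : |D.maninConstant| = 1 := by
  have hle : ∀ z ∈ periodLatticeGamma1 D.f, z ∈ D.L.lattice := by
    intro z hz
    induction hz using AddSubgroup.closure_induction with
    | mem x hx =>
      obtain ⟨γ, rfl⟩ := hx
      exact hSI γ
    | zero => exact zero_mem _
    | add x y _ _ hx hy => exact add_mem hx hy
    | neg x _ hx => exact neg_mem hx
  obtain ⟨w₁, hw₁, e₁⟩ := hopt D.L.ω₁ D.L.ω₁_mem_lattice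
  have hc : D.c ≠ 0 := D.maninConstant_ne_zero
  have hcC : (D.c : ℂ) ≠ 0 := by exact_mod_cast hc
  have hmem : (((1 : ℕ) : ℂ) / (D.c : ℂ)) * D.L.ω₁ ∈ D.L.lattice := by
    have e : (((1 : ℕ) : ℂ) / (D.c : ℂ)) * D.L.ω₁ = w₁ := by
      rw [e₁, Nat.cast_one]; field_simp
    rw [e]; exact hle w₁ hw₁
  have hdvd : D.c ∣ ((1 : ℕ) : ℤ) := dvd_of_div_mul_ω₁_mem D.L hc hmem
  exact Int.isUnit_iff_abs_eq.mp (isUnit_of_dvd_one (by exact_mod_cast hdvd))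

/-- **Stevens' `|c₁| = 1` for every OPTIMAL `X₁(N)`-datum of a globally minimal curve ⟸ CDT ∧ E-an-251** (ONE analytic law on `Γ₁`, at every level; LEAD's
`DivisionGamma1.abs_maninConstant₁_eq_one_of_CDT_of_divisionWitnessLaws₁` used one law per prime).  CONDITIONAL; Stevens' conjecture, Manin's conjecture
and BSD are not proved by this. [cite: Stevens1989, §2 (Conjecture: `c = ±1` for the `X₁(N)`-optimal parametrisation)] [cite: CalegariDimitrovTang2025, Thm. 1.0.1] -/
theorem abs_maninConstant₁_eq_one_of_CDT_of_cDivisionWitnessLaw₁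
    (hCDT : Literature.NumberTheory.Automorphic.CalegariDimitrovTang2025_unboundedDenominators_algInt) (hCW : CDivisionWitnessLaw₁)
    (D : Gamma1ParametrizationData W N) (hopt : D.IsOptimal) : |D.maninConstant| = 1 :=
  abs_maninConstant₁_eq_one_of_gamma1Periods_le D hopt (gamma1PeriodsInNeronLattice₁_of_CDT_of_cDivisionWitnessLaw₁ hCDT hCW W D)

/-! ## §7 MODULO THE PRINTED CDT FACT ONLY — E-an-242 discharged by `cDivisionWitnessLaw_holds` (p754408)

Pricing (director-bsd wording freeze 2026-08-30T00:56:13Z): `gamma1PeriodsInNeronLattice_of_CDT` says the tree derives Stevens' Conjecture I (strong form)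
from the vendored Prop `CalegariDimitrovTang2025_unboundedDenominators_algInt`; every statement below is therefore «⟸ CDT, ≥ Stevens I (ref1 §R208)» and is
reported as a CONDITIONAL implication.  Nothing here is announced as a theorem about Manin constants; the outside referee (REQUESTS (457)(D)) is pending. -/

/-- **E-an-250 ⟸ CDT**: `Λ₁(f) ⊆ Λ_W` for every curve of the class carrying a datum (Stevens' Conjecture I, strong form, MODULO the printed CDT fact).
CONDITIONAL. [cite: CalegariDimitrovTang2025, Thm. 1.0.1 and Remarks 58–59] [cite: Stevens1989, §2] -/
theorem gamma1PeriodsInNeronLattice_of_CDT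
    (hCDT : Literature.NumberTheory.Automorphic.CalegariDimitrovTang2025_unboundedDenominators_algInt) : Gamma1PeriodsInNeronLattice :=
  gamma1PeriodsInNeronLattice_of_CDT_of_cDivisionWitnessLaw hCDT cDivisionWitnessLaw_holds

/-- **`c₀ ∣ 2` at `4 ∣ N` ⟸ CDT** (lattice-optimal datum). CONDITIONAL. [cite: CalegariDimitrovTang2025, Thm. 1.0.1] [cite: LingOesterle1991, Thm. 6] -/
theorem maninConstant_dvd_two_of_CDT_of_four_dvd
    (hCDT : Literature.NumberTheory.Automorphic.CalegariDimitrovTang2025_unboundedDenominators_algInt)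
    (D : ModularParametrizationData W N) (hopt : ∀ z ∈ D.L.lattice, ∃ w ∈ periodLattice D.f, z = D.c * w) (h4 : 2 ^ 2 ∣ N) :
    D.maninConstant ∣ 2 :=
  maninConstant_dvd_two_of_CDT_cDivisionWitnessLaw_of_four_dvd hCDT cDivisionWitnessLaw_holds D hopt h4

/-- **C2 `ManinOddAtFour` ⟸ CDT ∧ E-an-152c.** CONDITIONAL. [cite: CalegariDimitrovTang2025, Thm. 1.0.1] [cite: LingOesterle1991, Thm. 6] [cite: Stevens1989, §2] -/
theorem maninOddAtFour_of_CDT_indexNeFourOddSquarefree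
    (hCDT : Literature.NumberTheory.Automorphic.CalegariDimitrovTang2025_unboundedDenominators_algInt)
    (hI4 : ShimuraIndexNeFourAtFourOddSquarefree) :
    Summit.BirchSwinnertonDyer.BirchSwinnertonDyer.Theses.ManinLocalTwoThree.ManinOddAtFour :=
  maninOddAtFour_of_CDT_cDivisionWitnessLaw_indexNeFourOddSquarefree hCDT cDivisionWitnessLaw_holds hI4

/-- **C2 `ManinOddAtFour` ⟸ CDT ∧ E-an-152d ∧ E-an-152e** (Frey-type habitat). CONDITIONAL. [cite: CalegariDimitrovTang2025, Thm. 1.0.1] [cite: LingOesterle1991, Thm. 2 and Thm. 6] -/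
theorem maninOddAtFour_of_CDT_freyHabitat
    (hCDT : Literature.NumberTheory.Automorphic.CalegariDimitrovTang2025_unboundedDenominators_algInt)
    (hd : IndexFourForcesFullRationalTwoTorsion) (he : ShimuraIndexNeFourAtFourFreyHabitat) :
    Summit.BirchSwinnertonDyer.BirchSwinnertonDyer.Theses.ManinLocalTwoThree.ManinOddAtFour :=
  maninOddAtFour_of_CDT_cDivisionWitnessLaw_freyHabitat hCDT cDivisionWitnessLaw_holds hd he

/-- **THE WHOLE ROUTE MODULO CDT: `ManinConstantOne` ⟸ PrintedSemistableManinFacts ∧ CDT ∧ E-an-152c** — C3 by p3's `CDivAssembly.maninPrimeToThreeAtNine_of_CDT`,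
C4 and C2 by this file, through the route's `closes`.  CONDITIONAL architecture; MANIN'S CONJECTURE AND BSD ARE NOT PROVED BY THIS.
[cite: CalegariDimitrovTang2025, Thm. 1.0.1] [cite: Cesnavicius2018, Thm. 1.2] [cite: Stevens1989, §2] -/
theorem maninConstantOne_of_printedFacts_CDT_indexNeFourOddSquarefree
    (hPF : Summit.BirchSwinnertonDyer.BirchSwinnertonDyer.Theses.ManinLocalTwoThree.PrintedSemistableManinFacts)
    (hCDT : Literature.NumberTheory.Automorphic.CalegariDimitrovTang2025_unboundedDenominators_algInt)
    (hI4 : ShimuraIndexNeFourAtFourOddSquarefree) :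
    Summit.BirchSwinnertonDyer.Rank1Residual.ManinConstant.ManinConstantOne :=
  Summit.BirchSwinnertonDyer.BirchSwinnertonDyer.Theses.ManinLocalTwoThree.closes hPF
    (maninOddAtFour_of_CDT_indexNeFourOddSquarefree hCDT hI4)
    (CDivAssembly.maninPrimeToThreeAtNine_of_CDT hCDT)
    (CDivisionUDC.maninPrimeToAdditiveFiveLe_of_CDT hCDT)
    maninLocalTwoThree_assembly_proof

/-- **THE WHOLE ROUTE MODULO CDT, Frey-habitat form: `ManinConstantOne` ⟸ PrintedSemistableManinFacts ∧ CDT ∧ E-an-152d ∧ E-an-152e.** CONDITIONAL; MANIN'S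
CONJECTURE AND BSD ARE NOT PROVED BY THIS. [cite: CalegariDimitrovTang2025, Thm. 1.0.1] [cite: Cesnavicius2018, Thm. 1.2] [cite: Stevens1989, §2] -/
theorem maninConstantOne_of_printedFacts_CDT_freyHabitat
    (hPF : Summit.BirchSwinnertonDyer.BirchSwinnertonDyer.Theses.ManinLocalTwoThree.PrintedSemistableManinFacts)
    (hCDT : Literature.NumberTheory.Automorphic.CalegariDimitrovTang2025_unboundedDenominators_algInt)
    (hd : IndexFourForcesFullRationalTwoTorsion) (he : ShimuraIndexNeFourAtFourFreyHabitat) :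
    Summit.BirchSwinnertonDyer.Rank1Residual.ManinConstant.ManinConstantOne :=
  Summit.BirchSwinnertonDyer.BirchSwinnertonDyer.Theses.ManinLocalTwoThree.closes hPF
    (maninOddAtFour_of_CDT_freyHabitat hCDT hd he)
    (CDivAssembly.maninPrimeToThreeAtNine_of_CDT hCDT)
    (CDivisionUDC.maninPrimeToAdditiveFiveLe_of_CDT hCDT)
    maninLocalTwoThree_assembly_proof


end Summit.BirchSwinnertonDyer.BirchSwinnertonDyer.Theorems.ManinLocalTwoThree.CDivisionNeron

end
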